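import Literature.Analysis.FluidPDE.KNSSMollifiedSlice
import Literature.Analysis.FluidPDE.NSBoundedMildOseenClassical
import Literature.Analysis.FunctionSpaces.DistributionalConstancy
import HarnessLib

/-!
# Bounded weak solutions with smooth slices: the time-integrated projected momentum equation

Analysis/FluidPDE proofs file (Koch–Nadirashvili–Seregin–Šverák, Acta Math. 203 (2009) =
arXiv:0709.3599v1, §4 p. 8: for the smooth representative `u` delivered by Lemma 3.1 and
Proposition 4.1, "the equation for `ω` … is satisfied in the sense of distributions" — the
passage from KNSS's weak formulation (ii) (solenoidal space–time tests, no pressure) to the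
equations satisfied slice by slice). Let `u` be a bounded weak Navier–Stokes solution on
`(a, T) × E` (`IsBoundedWeakNSSolutionOn`, any finite-dimensional `E`, any viscosity `ν`) whose
slices `u(t, ·)`, `t ∈ (a, T)`, are `C²` with `u, Du, Δu` bounded on the window and jointly
continuous in `(t, x)` together with `Du`, `Δu`. Then for all `a < s ≤ t < T` and every smooth
compactly supported divergence-free `φ`:

  `∫ ⟪u(t) − u(s) − ∫ₛᵗ (νΔu(τ) − (u(τ)·∇)u(τ)) dτ, φ⟫ dx = 0`

(`IsBoundedWeakNSSolutionOn.integral_inner_sub_sub_integral_eq_zero`): the increment of `u` minus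
the time integral of `νΔu − (u·∇)u` is orthogonal to the solenoidal tests, i.e. it is a gradient
(de Rham; the sequel file takes its curl). No time derivative of `u` and no joint smoothness are
used — only continuity in time — which is the regularity the tree's a priori bootstrap of bounded
mild solutions provides (`KNSSMildBootstrapStep`, `KNSSMildRegularityTime`).

## Proof

Tensor tests `ψ = η ⊗ φ`, `η ∈ C_c^∞((a, T))`, in the weak identity give
`∫ (η' G + η K) dt = 0` with `G(t) = ∫⟪u(t), φ⟫` and
`K(t) = ∫ (⟪u, (u·∇)φ⟫ + ν⟪u, Δφ⟫)`; at a.e. `t` the slice is divergence free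
(`IsWeaklyDivFree.isDivFree_of_contDiff`), so integrating by parts in `x`,
`K(t) = H(t) = ∫⟪νΔu − (u·∇)u, φ⟫`. With `Φ(t) = G(t) − ∫ₛᵗ H`, continuous on the window,
`∫ η' Φ = 0` for all `η` (integration by parts against the absolutely continuous `∫ₛᵗ H`), so `Φ`
is constant (`ae_eq_const_of_forall_setIntegral_deriv_mul_eq_zero` and continuity), i.e.
`G(t) − G(s) = ∫ₛᵗ H`; Fubini on `[s, t] × supp φ` moves the time integral inside.

## References

* G. Koch, N. Nadirashvili, G. Seregin, V. Šverák, Acta Math. 203 (2009) = arXiv:0709.3599v1,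
  §3 p. 7 (weak solutions), §4 p. 8 ((ii) and the closing paragraph, (4.8)).
  [KochNadirashviliSereginSverak2009]
-/

noncomputable section

open MeasureTheory TopologicalSpace Set Function Filter Metric InnerProductSpace intervalIntegral
open _root_.Topology
open scoped ENNReal NNReal Laplacian RealInnerProductSpace ContDiff

namespace Literature.Analysis.FluidPDE

variable {E : Type*} [NormedAddCommGroup E] [InnerProductSpace ℝ E] [FiniteDimensional ℝ E]
  [MeasurableSpace E] [BorelSpace E]

/-! ### Tensor tests on a time window -/

omit [MeasurableSpace E] [BorelSpace E] in
/-- The tensor test `η ⊗ φ` with `tsupport η ⊆ (a, T)` is a space–time test field on the slab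
`(a, T) × E`. [folklore] -/
theorem isSpaceTimeTestOn_tensorTest {η : ℝ → ℝ} (hη : ContDiff ℝ ∞ η) (hηs : HasCompactSupport η)
    {a T : ℝ} (hηJ : tsupport η ⊆ Ioo a T) {φ : E → E} (hφ : ContDiff ℝ ∞ φ)
    (hφs : HasCompactSupport φ) :
    IsSpaceTimeTestOn (slab E (Ioo a T) isOpen_Ioo) (fun t x => η t • φ x) := by
  obtain ⟨hs, hc, -, -, -⟩ := tensorTest_props hη hηs hφ hφs
  refine ⟨hs, hc, ?_⟩
  -- `tsupport ⊆ tsupport η ×ˢ univ ⊆ (a, T) × E`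
  have hsub : support (uncurry fun t x => η t • φ x) ⊆ tsupport η ×ˢ (univ : Set E) := by
    intro z hz
    refine ⟨subset_tsupport _ fun h0 => hz ?_, mem_univ _⟩
    change η z.1 • φ z.2 = 0
    rw [h0, zero_smul]
  have hcl : IsClosed (tsupport η ×ˢ (univ : Set E)) := (isClosed_tsupport _).prod isClosed_univ
  refine (closure_minimal hsub hcl).trans ?_
  rintro ⟨t, x⟩ ⟨ht, -⟩
  rw [SetLike.mem_coe, mem_slab]
  exact hηJ ht

/-! ### Continuity in time of slice pairings -/

/-- **Continuity of `t ↦ ∫⟪V(t), φ⟫` on an open time set** for a family jointly continuous on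
`S × E` and bounded there, against a continuous compactly supported `φ` (dominated convergence).
[folklore] -/
theorem continuousOn_integral_inner_of_bound {S : Set ℝ} {V : ℝ → E → E}
    (hVc : ContinuousOn (uncurry V) (S ×ˢ univ)) {B : ℝ} (hVb : ∀ t ∈ S, ∀ x, ‖V t x‖ ≤ B)
    {φ : E → E} (hφc : Continuous φ) (hφs : HasCompactSupport φ) :
    ContinuousOn (fun t => ∫ x, ⟪V t x, φ x⟫) S := by
  intro t₀ ht₀
  have hmem : ∀ᶠ t in 𝓝[S] t₀, t ∈ S := self_mem_nhdsWithin
  have hsl : ∀ x, ContinuousOn (fun t => V t x) S := fun x =>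
    hVc.comp (continuous_id.prodMk continuous_const).continuousOn fun t ht => ⟨ht, mem_univ _⟩
  have hxc : ∀ t ∈ S, Continuous fun x => V t x := fun t ht =>
    hVc.comp_continuous (continuous_const.prodMk continuous_id) fun x => ⟨ht, mem_univ _⟩
  refine continuousWithinAt_of_dominated (bound := fun x => B * ‖φ x‖) ?_ ?_
    ((hφc.norm.integrable_of_hasCompactSupport hφs.norm).const_mul B) ?_
  · filter_upwards [hmem] with t ht
    exact ((hxc t ht).inner hφc).aestronglyMeasurable
  · filter_upwards [hmem] with t ht
    exact Eventually.of_forall fun x =>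
      (norm_inner_le_norm _ _).trans (mul_le_mul_of_nonneg_right (hVb t ht x) (norm_nonneg _))
  · exact Eventually.of_forall fun x => ((hsl x) t₀ ht₀).inner continuousWithinAt_const

/-! ### Distributional derivative of a continuous function: the fundamental theorem -/

/-- **If the distributional derivative of a continuous `G` on `(a, T)` is the continuous `H`,
then `G(t) − G(s) = ∫ₛᵗ H`.** Hypotheses: `G`, `H` continuous and bounded on `(a, T)` and
`∫_{(a,T)} (η' G + η H) = 0` for all smooth `η` compactly supported in `(a, T)`. Proof: with
`Φ = G − ∫ₛ H` one has `∫ η' Φ = 0` (integration by parts against the absolutely continuous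
primitive), so `Φ` is a.e. constant (`ae_eq_const_of_forall_setIntegral_deriv_mul_eq_zero`),
hence constant by continuity. [folklore] -/
theorem sub_eq_integral_of_forall_integral_deriv_mul_add {a T : ℝ} {G H : ℝ → ℝ}
    (hGc : ContinuousOn G (Ioo a T)) (hHc : ContinuousOn H (Ioo a T)) {CG CH : ℝ}
    (hGb : ∀ τ ∈ Ioo a T, |G τ| ≤ CG) (hHb : ∀ τ ∈ Ioo a T, |H τ| ≤ CH)
    (h : ∀ η : ℝ → ℝ, ContDiff ℝ ∞ η → HasCompactSupport η → tsupport η ⊆ Ioo a T →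
      ∫ τ in Ioo a T, (deriv η τ * G τ + η τ * H τ) = 0)
    {s t : ℝ} (hs : a < s) (hst : s ≤ t) (ht : t < T) :
    G t - G s = ∫ τ in s..t, H τ := by
  set J : Set ℝ := Ioo a T with hJ
  have hJo : IsOpen J := isOpen_Ioo
  have hsJ : s ∈ J := ⟨hs, hst.trans_lt ht⟩
  have htJ : t ∈ J := ⟨hs.trans_le hst, ht⟩
  -- the truncated `H` (measurable on `ℝ`, equal to `H` on `J`) and its primitive from `s`
  set H' : ℝ → ℝ := J.piecewise H 0 with hH'
  have hH'J : ∀ τ ∈ J, H' τ = H τ := fun τ hτ => piecewise_eq_of_mem _ _ _ hτ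
  have hH'm : Measurable H' := hHc.measurable_piecewise continuousOn_const hJo.measurableSet
  have hCH0 : 0 ≤ CH := (abs_nonneg _).trans (hHb s hsJ)
  have hH'b : ∀ τ, |H' τ| ≤ CH := fun τ => by
    by_cases hτ : τ ∈ J
    · rw [hH'J τ hτ]; exact hHb τ hτ
    · rw [hH', piecewise_eq_of_notMem _ _ _ hτ]; simpa using hCH0
  have hH'i : ∀ x y, IntervalIntegrable H' volume x y := fun x y => by
    have hc : IntervalIntegrable (fun _ : ℝ => CH) (volume : Measure ℝ) x y := intervalIntegrable_const
    exact hc.mono_fun' hH'm.aestronglyMeasurable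
      (Eventually.of_forall fun τ => by simpa [Real.norm_eq_abs] using hH'b τ)
  set V : ℝ → ℝ := fun τ => ∫ x in s..τ, H' x with hV
  have hVc : Continuous V := continuous_primitive hH'i s
  have hVd : ∀ τ ∈ J, HasDerivAt V (H τ) τ := fun τ hτ => by
    have hca : ContinuousAt H' τ := by
      have h1 : ContinuousAt H τ := hHc.continuousAt (hJo.mem_nhds hτ)
      refine h1.congr ?_
      filter_upwards [hJo.mem_nhds hτ] with σ hσ
      exact (hH'J σ hσ).symm
    have h := integral_hasDerivAt_right (hH'i s τ) hH'm.stronglyMeasurable.stronglyMeasurableAtFilter hca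
    rwa [hH'J τ hτ] at h
  -- `Φ = G − V` has vanishing distributional derivative on `J`
  set Φ : ℝ → ℝ := fun τ => G τ - V τ with hΦ
  have hΦc : ContinuousOn Φ J := hGc.sub hVc.continuousOn
  have hVb : ∀ τ ∈ J, |V τ| ≤ CH * (T - a) := fun τ hτ => by
    have h1 : |V τ| ≤ CH * |τ - s| := by
      simpa [hV] using norm_integral_le_of_norm_le_const (f := H') (a := s) (b := τ) (C := CH)
        (fun x _ => by simpa [Real.norm_eq_abs] using hH'b x)
    refine h1.trans (mul_le_mul_of_nonneg_left ?_ hCH0)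
    rw [abs_le]
    constructor <;> linarith [hτ.1, hτ.2, hsJ.1, hsJ.2]
  have hΦb : ∀ τ ∈ J, |Φ τ| ≤ CG + CH * (T - a) := fun τ hτ =>
    (abs_sub _ _).trans (add_le_add (hGb τ hτ) (hVb τ hτ))
  have hΦint : IntegrableOn Φ J := by
    refine Integrable.mono' (integrableOn_const (C := CG + CH * (T - a)) (by
      rw [hJ, Real.volume_Ioo]; exact ENNReal.ofReal_ne_top))
      (hΦc.aestronglyMeasurable hJo.measurableSet) ?_
    filter_upwards [ae_restrict_mem hJo.measurableSet] with τ hτ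
    rw [Real.norm_eq_abs]
    exact hΦb τ hτ
  have hstep : ∀ η : ℝ → ℝ, ContDiff ℝ ∞ η → HasCompactSupport η → tsupport η ⊆ J →
      ∫ τ in J, deriv η τ * Φ τ = 0 := by
    intro η hη hηs hηJ
    have hηc : Continuous η := hη.continuous
    have hη'c : Continuous (deriv η) := hη.continuous_deriv (by simp)
    have hη's : HasCompactSupport (deriv η) := hηs.deriv
    have hη'J : tsupport (deriv η) ⊆ J := tsupport_deriv_subset.trans hηJ
    have hηz : ∀ τ, τ ∉ J → η τ = 0 := fun τ hτ => image_eq_zero_of_notMem_tsupport fun h => hτ (hηJ h)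
    have hη'z : ∀ τ, τ ∉ J → deriv η τ = 0 := fun τ hτ =>
      image_eq_zero_of_notMem_tsupport fun h => hτ (hη'J h)
    -- integration by parts on the line: `∫ V η' = -∫ H' η`
    have i1 : Integrable (V * deriv η) := (hVc.mul hη'c).integrable_of_hasCompactSupport hη's.mul_left
    have i2 : Integrable (H' * η) :=
      (hηc.integrable_of_hasCompactSupport (μ := volume) hηs).bdd_mul (c := CH)
        hH'm.aestronglyMeasurable
        (Eventually.of_forall fun τ => by simpa [Real.norm_eq_abs] using hH'b τ)
    have i3 : Integrable (V * η) := (hVc.mul hηc).integrable_of_hasCompactSupport hηs.mul_left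
    have hibp : ∫ τ, V τ * deriv η τ = -∫ τ, H' τ * η τ :=
      integral_mul_deriv_eq_deriv_mul_of_integrable (u := V) (u' := H') (v := η) (v' := deriv η)
        (fun τ hτ => by rw [hH'J τ (hηJ hτ)]; exact hVd τ (hηJ hτ))
        (fun τ _ => (hη.differentiable (by simp) τ).hasDerivAt) i1 i2 i3
    -- back to integrals over `J`
    have e1 : ∫ τ in J, deriv η τ * V τ = ∫ τ, V τ * deriv η τ := by
      rw [setIntegral_eq_integral_of_forall_compl_eq_zero fun τ hτ => by rw [hη'z τ hτ, zero_mul]]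
      exact integral_congr_ae (Eventually.of_forall fun τ => by beta_reduce; exact mul_comm _ _)
    have e2 : ∫ τ, H' τ * η τ = ∫ τ in J, η τ * H τ := by
      rw [setIntegral_eq_integral_of_forall_compl_eq_zero fun τ hτ => by rw [hηz τ hτ, zero_mul]]
      refine integral_congr_ae (Eventually.of_forall fun τ => ?_)
      beta_reduce
      by_cases hτ : τ ∈ J
      · rw [hH'J τ hτ, mul_comm]
      · rw [hηz τ hτ, mul_zero, zero_mul]
    have iG : IntegrableOn (fun τ => deriv η τ * G τ) J := by
      refine Integrable.mono' ((hη'c.integrable_of_hasCompactSupport hη's).norm.mul_const CG).integrableOn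
        ((hη'c.continuousOn.mul hGc).aestronglyMeasurable hJo.measurableSet) ?_
      filter_upwards [ae_restrict_mem hJo.measurableSet] with τ hτ
      rw [norm_mul]
      exact mul_le_mul_of_nonneg_left (by simpa [Real.norm_eq_abs] using hGb τ hτ) (norm_nonneg _)
    have iV : IntegrableOn (fun τ => deriv η τ * V τ) J :=
      ((hη'c.mul hVc).integrable_of_hasCompactSupport hη's.mul_right).integrableOn
    have iH : IntegrableOn (fun τ => η τ * H τ) J := by
      refine Integrable.mono' ((hηc.integrable_of_hasCompactSupport hηs).norm.mul_const CH).integrableOn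
        ((hηc.continuousOn.mul hHc).aestronglyMeasurable hJo.measurableSet) ?_
      filter_upwards [ae_restrict_mem hJo.measurableSet] with τ hτ
      rw [norm_mul]
      exact mul_le_mul_of_nonneg_left (by simpa [Real.norm_eq_abs] using hHb τ hτ) (norm_nonneg _)
    have hsplit : ∫ τ in J, deriv η τ * Φ τ = (∫ τ in J, deriv η τ * G τ) - ∫ τ in J, deriv η τ * V τ := by
      rw [← integral_sub iG iV]
      exact integral_congr_ae (Eventually.of_forall fun τ => by beta_reduce; simp only [hΦ]; ring)
    have h0 := h η hη hηs hηJ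
    rw [integral_add iG iH] at h0
    rw [hsplit, e1, hibp, e2]
    linarith
  obtain ⟨c, hc⟩ := FunctionSpaces.ae_eq_const_of_forall_setIntegral_deriv_mul_eq_zero hΦint hstep
  have hΦeq : EqOn Φ (fun _ => c) J :=
    Measure.eqOn_open_of_ae_eq hc hJo hΦc continuousOn_const
  have hts : Φ t = Φ s := by rw [hΦeq htJ, hΦeq hsJ]
  have hVs : V s = 0 := by simp [hV]
  have hVt : V t = ∫ τ in s..t, H τ := by
    refine intervalIntegral.integral_congr fun τ hτ => hH'J τ ?_
    rw [uIcc_of_le hst] at hτ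
    exact ⟨hs.trans_le hτ.1, hτ.2.trans_lt ht⟩
  simp only [hΦ, hVs, sub_zero] at hts
  linarith

/-! ### The time-integrated projected momentum equation -/

section Main

variable {a T ν : ℝ} {u : ℝ → E → E}

/-- **Slice integration by parts**: for a `C²` divergence-free field `w`, a test field `φ` and
any `ν`, `∫ (⟪w, Dφ[w]⟫ + ν⟪w, Δφ⟫) = ∫ ⟪νΔw − Dw[w], φ⟫`. [folklore] -/
theorem integral_inner_fderiv_add_laplacian_eq {w : E → E} (hw : ContDiff ℝ 2 w)
    (hdivw : VectorCalculus.IsDivFree w) {φ : E → E} (hφ : ContDiff ℝ 2 φ)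
    (hφs : HasCompactSupport φ) (ν : ℝ) :
    ∫ x, (⟪w x, fderiv ℝ φ x (w x)⟫ + ν * ⟪w x, (Δ φ) x⟫) =
      ∫ x, ⟪ν • (Δ w) x - fderiv ℝ w x (w x), φ x⟫ := by
  have hw1 : ContDiff ℝ 1 w := hw.of_le one_le_two
  have hφ1 : ContDiff ℝ 1 φ := hφ.of_le one_le_two
  have hwc : Continuous w := hw.continuous
  have hDwc : Continuous (fderiv ℝ w) := hw1.continuous_fderiv one_ne_zero
  have hφc : Continuous φ := hφ.continuous
  have hDφc : Continuous (fderiv ℝ φ) := hφ1.continuous_fderiv one_ne_zero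
  have hDφs : HasCompactSupport (fderiv ℝ φ) := hφs.fderiv ℝ
  have hΔφc : Continuous (Δ φ) := continuous_laplacian hφ
  have hΔφs : HasCompactSupport (Δ φ) :=
    hφs.mono' fun x hx => by
      by_contra h
      exact hx (laplacian_eq_zero_of_notMem_tsupport h)
  have e1 : ∫ x, ⟪w x, fderiv ℝ φ x (w x)⟫ = -∫ x, ⟪fderiv ℝ w x (w x), φ x⟫ := by
    have h0 := integral_inner_convect_add_eq_zero hw1 hw1 hφ1 hφs
    have hz : ∫ x, VectorCalculus.divergence w x * ⟪w x, φ x⟫ = 0 := by simp [hdivw _]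
    simp only [convect_apply] at h0
    linarith
  have e2 : ∫ x, ⟪w x, (Δ φ) x⟫ = ∫ x, ⟪(Δ w) x, φ x⟫ := (integral_inner_laplacian_comm hw hφ hφs).symm
  have i1 : Integrable fun x => ⟪w x, fderiv ℝ φ x (w x)⟫ :=
    integrable_inner_of_hasCompactSupport_right hwc (hDφc.clm_apply hwc)
      (hDφs.mono fun x hx h0 => hx (by simp [h0]))
  have i2 : Integrable fun x => ⟪w x, (Δ φ) x⟫ := integrable_inner_of_hasCompactSupport_right hwc hΔφc hΔφs
  have iL : Integrable fun x => ⟪(Δ w) x, φ x⟫ :=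
    integrable_inner_of_hasCompactSupport_right (continuous_laplacian hw) hφc hφs
  have iC : Integrable fun x => ⟪fderiv ℝ w x (w x), φ x⟫ :=
    integrable_inner_of_hasCompactSupport_right (hDwc.clm_apply hwc) hφc hφs
  rw [integral_add i1 (i2.const_mul ν), MeasureTheory.integral_const_mul, e1, e2]
  have hpt : (fun x => ⟪ν • (Δ w) x - fderiv ℝ w x (w x), φ x⟫) =
      fun x => ν * ⟪(Δ w) x, φ x⟫ - ⟪fderiv ℝ w x (w x), φ x⟫ := by
    funext x
    rw [inner_sub_left, inner_smul_left]
    simp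
  rw [hpt, integral_sub (iL.const_mul ν) iC, MeasureTheory.integral_const_mul]
  ring

/-- **The weak identity on tensor tests**, for a bounded weak solution jointly continuous on
its window: for `η ∈ C_c^∞((a, T))` and a test field `φ` with `div φ = 0`,
`∫_{(a,T)} (η'(t) ∫⟪u(t), φ⟫ + η(t) ∫ (⟪u(t), Dφ[u(t)]⟫ + ν⟪u(t), Δφ⟫)) dt = 0`. [folklore] -/
theorem IsBoundedWeakNSSolutionOn.integral_tensorTest_eq_zero
    (hu : IsBoundedWeakNSSolutionOn (Ioo a T) isOpen_Ioo ν u)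
    (hc0 : ContinuousOn (uncurry u) (Ioo a T ×ˢ univ))
    {η : ℝ → ℝ} (hη : ContDiff ℝ ∞ η) (hηs : HasCompactSupport η) (hηJ : tsupport η ⊆ Ioo a T)
    {φ : E → E} (hφ : FunctionSpaces.IsTestFunctionOn (⊤ : Opens E) φ)
    (hdiv : VectorCalculus.IsDivFree φ) :
    ∫ τ in Ioo a T, (deriv η τ * (∫ x, ⟪u τ x, φ x⟫) +
      η τ * ∫ x, (⟪u τ x, fderiv ℝ φ x (u τ x)⟫ + ν * ⟪u τ x, (Δ φ) x⟫)) = 0 := by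
  have hφi : ContDiff ℝ ∞ φ := hφ.contDiff
  have hφ2 : ContDiff ℝ 2 φ := contDiff_infty.1 hφi 2
  have hφ1 : ContDiff ℝ 1 φ := contDiff_infty.1 hφi 1
  have hφs : HasCompactSupport φ := hφ.hasCompactSupport
  have hφc : Continuous φ := hφi.continuous
  have hDφc : Continuous (fderiv ℝ φ) := hφ1.continuous_fderiv one_ne_zero
  have hDφs : HasCompactSupport (fderiv ℝ φ) := hφs.fderiv ℝ
  have hΔφc : Continuous (Δ φ) := continuous_laplacian hφ2
  have hΔφs : HasCompactSupport (Δ φ) :=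
    hφs.mono' fun x hx => by
      by_contra h
      exact hx (laplacian_eq_zero_of_notMem_tsupport h)
  have hxc : ∀ τ ∈ Ioo a T, Continuous fun x => u τ x := fun τ hτ =>
    hc0.comp_continuous (continuous_const.prodMk continuous_id) fun x => ⟨hτ, mem_univ _⟩
  obtain ⟨-, -, hΦt, hΦD, hΦL⟩ := tensorTest_props hη hηs hφi hφs
  have hψ := isSpaceTimeTestOn_tensorTest hη hηs hηJ hφi hφs
  have hψdiv : ∀ τ, VectorCalculus.IsDivFree (fun x => η τ • φ x) := fun τ x => by
    rw [divergence_const_smul_apply ((hφi.differentiable (by simp)) x), hdiv x, mul_zero]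
  have key := hu.2.2.2 _ hψ hψdiv
  have hpt : ∀ τ x, ⟪u τ x, timeDeriv (fun t x => η t • φ x) τ x⟫ +
      ⟪u τ x, convect (u τ) (fun x => η τ • φ x) x⟫ + ν * ⟪u τ x, (Δ (fun x => η τ • φ x)) x⟫ =
      deriv η τ * ⟪u τ x, φ x⟫ + η τ * (⟪u τ x, fderiv ℝ φ x (u τ x)⟫ + ν * ⟪u τ x, (Δ φ) x⟫) := by
    intro τ x
    rw [hΦt τ x, convect_apply, hΦD τ x, hΦL τ x, inner_smul_right, FunLike.coe_smul,
      Pi.smul_apply, inner_smul_right, inner_smul_right]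
    ring
  have hslice : ∀ τ ∈ Ioo a T, (∫ x, (⟪u τ x, timeDeriv (fun t x => η t • φ x) τ x⟫ +
      ⟪u τ x, convect (u τ) (fun x => η τ • φ x) x⟫ + ν * ⟪u τ x, (Δ (fun x => η τ • φ x)) x⟫)) =
      deriv η τ * (∫ x, ⟪u τ x, φ x⟫) +
        η τ * ∫ x, (⟪u τ x, fderiv ℝ φ x (u τ x)⟫ + ν * ⟪u τ x, (Δ φ) x⟫) := by
    intro τ hτ
    rw [integral_congr_ae (Eventually.of_forall (hpt τ))]
    have i0 : Integrable fun x => ⟪u τ x, φ x⟫ :=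
      integrable_inner_of_hasCompactSupport_right (hxc τ hτ) hφc hφs
    have i1 : Integrable fun x => ⟪u τ x, fderiv ℝ φ x (u τ x)⟫ :=
      integrable_inner_of_hasCompactSupport_right (hxc τ hτ) (hDφc.clm_apply (hxc τ hτ))
        (hDφs.mono fun x hx h0 => hx (by simp [h0]))
    have i2 : Integrable fun x => ⟪u τ x, (Δ φ) x⟫ :=
      integrable_inner_of_hasCompactSupport_right (hxc τ hτ) hΔφc hΔφs
    have i12 : Integrable fun x => ⟪u τ x, fderiv ℝ φ x (u τ x)⟫ + ν * ⟪u τ x, (Δ φ) x⟫ :=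
      i1.add (i2.const_mul ν)
    rw [integral_add (i0.const_mul _) (i12.const_mul _), MeasureTheory.integral_const_mul,
      MeasureTheory.integral_const_mul]
  rw [setIntegral_congr_fun measurableSet_Ioo hslice] at key
  exact key

/-- **Bounded weak solutions with `C²` slices: the time-integrated projected momentum equation.**
Let `u` be a bounded weak Navier–Stokes solution on `(a, T) × E` (KNSS's class, solenoidal
space–time tests), bounded by `M`, whose slices `u(t, ·)`, `t ∈ (a, T)`, are `C²` with
`‖Du‖, ‖Δu‖ ≤ B` on the window, and such that `u`, `Du`, `Δu` are jointly continuous on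
`(a, T) × E`. Then for `a < s ≤ t < T` and every smooth compactly supported divergence-free `φ`,
`∫ ⟪u(t) − u(s) − ∫ₛᵗ (νΔu(τ) − Du(τ)[u(τ)]) dτ, φ⟫ dx = 0`
(tensor tests, integration by parts in `x` at a.e. time, distributional constancy in `t`,
continuity, Fubini). This is the form in which "(4.8) is satisfied in the sense of distributions"
(KNSS 2009, §4 p. 8) is extracted from the weak formulation (ii), without time derivatives of
`u`. [cite: KochNadirashviliSereginSverak2009, §4 p. 8 ((ii) and (4.8)) with §3 p. 7 (arXiv:0709.3599v1)] -/
theorem IsBoundedWeakNSSolutionOn.integral_inner_sub_sub_integral_eq_zero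
    (hu : IsBoundedWeakNSSolutionOn (Ioo a T) isOpen_Ioo ν u) {M : ℝ}
    (hM : ∀ t ∈ Ioo a T, ∀ x, ‖u t x‖ ≤ M) (h2 : ∀ t ∈ Ioo a T, ContDiff ℝ 2 (u t)) {B : ℝ}
    (hB1 : ∀ t ∈ Ioo a T, ∀ x, ‖fderiv ℝ (u t) x‖ ≤ B) (hB2 : ∀ t ∈ Ioo a T, ∀ x, ‖(Δ (u t)) x‖ ≤ B)
    (hc0 : ContinuousOn (uncurry u) (Ioo a T ×ˢ univ))
    (hc1 : ContinuousOn (fun p : ℝ × E => fderiv ℝ (u p.1) p.2) (Ioo a T ×ˢ univ))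
    (hc2 : ContinuousOn (fun p : ℝ × E => (Δ (u p.1)) p.2) (Ioo a T ×ˢ univ))
    {s t : ℝ} (hs : a < s) (hst : s ≤ t) (ht : t < T) {φ : E → E}
    (hφ : FunctionSpaces.IsTestFunctionOn (⊤ : Opens E) φ) (hdiv : VectorCalculus.IsDivFree φ) :
    ∫ x, ⟪u t x - u s x - ∫ τ in s..t, (ν • (Δ (u τ)) x - fderiv ℝ (u τ) x (u τ x)), φ x⟫ = 0 := by
  set J : Set ℝ := Ioo a T with hJ
  have hJo : IsOpen J := isOpen_Ioo
  have hsJ : s ∈ J := ⟨hs, hst.trans_lt ht⟩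
  have htJ : t ∈ J := ⟨hs.trans_le hst, ht⟩
  have hM0 : 0 ≤ M := (norm_nonneg _).trans (hM s hsJ 0)
  have hB0 : 0 ≤ B := (norm_nonneg _).trans (hB1 s hsJ 0)
  -- the test field
  have hφi : ContDiff ℝ ∞ φ := hφ.contDiff
  have hφ2 : ContDiff ℝ 2 φ := contDiff_infty.1 hφi 2
  have hφs : HasCompactSupport φ := hφ.hasCompactSupport
  have hφc : Continuous φ := hφi.continuous
  have hφint : Integrable φ := hφc.integrable_of_hasCompactSupport hφs
  -- slices
  have hxc : ∀ τ ∈ J, Continuous fun x => u τ x := fun τ hτ =>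
    hc0.comp_continuous (continuous_const.prodMk continuous_id) fun x => ⟨hτ, mem_univ _⟩
  -- the right-hand side field `h = νΔu − Du[u]`: bounded, jointly continuous on the window
  obtain ⟨h, hh⟩ : ∃ h : ℝ → E → E, h = fun τ x => ν • (Δ (u τ)) x - fderiv ℝ (u τ) x (u τ x) :=
    ⟨_, rfl⟩
  obtain ⟨Ch, hCh⟩ : ∃ Ch : ℝ, Ch = |ν| * B + B * M := ⟨_, rfl⟩
  have hCh0 : 0 ≤ Ch := by rw [hCh]; positivity
  have hhb : ∀ τ ∈ J, ∀ x, ‖h τ x‖ ≤ Ch := fun τ hτ x => by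
    rw [hh, hCh]
    refine (norm_sub_le _ _).trans (add_le_add ?_ ?_)
    · rw [norm_smul, Real.norm_eq_abs]; exact mul_le_mul_of_nonneg_left (hB2 τ hτ x) (abs_nonneg _)
    · exact (ContinuousLinearMap.le_opNorm _ _).trans
        (mul_le_mul (hB1 τ hτ x) (hM τ hτ x) (norm_nonneg _) hB0)
  have hhc : ContinuousOn (uncurry h) (J ×ˢ univ) := by
    have happ : ContinuousOn (fun p : ℝ × E => fderiv ℝ (u p.1) p.2 (u p.1 p.2)) (J ×ˢ univ) :=
      (isBoundedBilinearMap_apply (𝕜 := ℝ) (E := E) (F := E)).continuous.comp_continuousOn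
        (hc1.prodMk hc0)
    rw [hh]
    exact (hc2.const_smul ν).sub happ
  -- the slice functionals `G`, `H`
  obtain ⟨G, hG⟩ : ∃ G : ℝ → ℝ, G = fun τ => ∫ x, ⟪u τ x, φ x⟫ := ⟨_, rfl⟩
  obtain ⟨H, hH⟩ : ∃ H : ℝ → ℝ, H = fun τ => ∫ x, ⟪h τ x, φ x⟫ := ⟨_, rfl⟩
  have hGc : ContinuousOn G J := by rw [hG]; exact continuousOn_integral_inner_of_bound hc0 hM hφc hφs
  have hHc : ContinuousOn H J := by rw [hH]; exact continuousOn_integral_inner_of_bound hhc hhb hφc hφs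
  have hGb : ∀ τ ∈ J, |G τ| ≤ M * ∫ x, ‖φ x‖ := fun τ hτ => by
    rw [hG, ← Real.norm_eq_abs, ← MeasureTheory.integral_const_mul]
    refine norm_integral_le_of_norm_le (hφint.norm.const_mul M) (Eventually.of_forall fun x => ?_)
    exact (norm_inner_le_norm _ _).trans (mul_le_mul_of_nonneg_right (hM τ hτ x) (norm_nonneg _))
  have hHb : ∀ τ ∈ J, |H τ| ≤ Ch * ∫ x, ‖φ x‖ := fun τ hτ => by
    rw [hH, ← Real.norm_eq_abs, ← MeasureTheory.integral_const_mul]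
    refine norm_integral_le_of_norm_le (hφint.norm.const_mul _) (Eventually.of_forall fun x => ?_)
    exact (norm_inner_le_norm _ _).trans (mul_le_mul_of_nonneg_right (hhb τ hτ x) (norm_nonneg _))
  -- at a.e. time, `K = H` (slice integration by parts, the slice being divergence free)
  have hK : ∀ᵐ τ ∂(volume.restrict J),
      (∫ x, (⟪u τ x, fderiv ℝ φ x (u τ x)⟫ + ν * ⟪u τ x, (Δ φ) x⟫)) = H τ := by
    filter_upwards [hu.2.2.1, ae_restrict_mem hJo.measurableSet] with τ hwdiv hτ
    have hdivτ : VectorCalculus.IsDivFree (u τ) := hwdiv.isDivFree_of_contDiff ((h2 τ hτ).of_le one_le_two)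
    rw [hH, hh]
    exact integral_inner_fderiv_add_laplacian_eq (h2 τ hτ) hdivτ hφ2 hφs ν
  -- the distributional identity `∫ (η' G + η H) = 0`
  have hdist : ∀ η : ℝ → ℝ, ContDiff ℝ ∞ η → HasCompactSupport η → tsupport η ⊆ J →
      ∫ τ in J, (deriv η τ * G τ + η τ * H τ) = 0 := by
    intro η hη hηs hηJ
    rw [← hu.integral_tensorTest_eq_zero hc0 hη hηs hηJ hφ hdiv]
    refine setIntegral_congr_ae hJo.measurableSet ?_
    filter_upwards [ae_imp_of_ae_restrict hK] with τ hτ hτJ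
    rw [hτ hτJ, hG]
  -- the fundamental theorem in `t`
  have hFTC : G t - G s = ∫ τ in s..t, H τ :=
    sub_eq_integral_of_forall_integral_deriv_mul_add hGc hHc hGb hHb hdist hs hst ht
  -- Fubini on `(s, t] × E`
  set μ : Measure ℝ := (volume : Measure ℝ).restrict (Ioc s t) with hμ
  have hIJ : Icc s t ⊆ J := fun τ hτ => ⟨hs.trans_le hτ.1, hτ.2.trans_lt ht⟩
  obtain ⟨F, hF⟩ : ∃ F : ℝ × E → ℝ, F = fun p => ⟪h p.1 p.2, φ p.2⟫ := ⟨_, rfl⟩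
  have hFc : ContinuousOn F (Icc s t ×ˢ univ) := by
    rw [hF]
    exact ((continuous_inner : Continuous fun p : E × E => ⟪p.1, p.2⟫).comp_continuousOn
      ((hhc.mono (prod_mono hIJ Subset.rfl)).prodMk (hφc.comp continuous_snd).continuousOn))
  have hFint : Integrable F (μ.prod volume) := by
    -- integrable on the compact `[s, t] × tsupport φ`, zero off it
    have hK : IsCompact (Icc s t ×ˢ tsupport φ) := isCompact_Icc.prod hφs
    have h1 : IntegrableOn F (Icc s t ×ˢ tsupport φ) (volume : Measure (ℝ × E)) :=
      (hFc.mono (prod_mono Subset.rfl (subset_univ _))).integrableOn_compact hK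
    have h2 : IntegrableOn F (Ioc s t ×ˢ univ) (volume : Measure (ℝ × E)) := by
      refine h1.of_ae_sdiff_eq_zero (measurableSet_Ioc.prod MeasurableSet.univ).nullMeasurableSet
        (Eventually.of_forall fun p hp => ?_)
      have hx : p.2 ∉ tsupport φ := fun hx => hp.2 ⟨Ioc_subset_Icc_self hp.1.1, hx⟩
      rw [hF]
      simp only [image_eq_zero_of_notMem_tsupport hx, inner_zero_right]
    have hμeq : (volume : Measure (ℝ × E)).restrict (Ioc s t ×ˢ univ) = μ.prod volume := by
      rw [hμ, Measure.volume_eq_prod, ← Measure.prod_restrict, Measure.restrict_univ]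
    rw [← hμeq]
    exact h2
  have hswap : ∫ τ in s..t, H τ = ∫ x, ∫ τ in Ioc s t, ⟪h τ x, φ x⟫ := by
    rw [intervalIntegral.integral_of_le hst, hH]
    rw [hF] at hFint
    exact integral_integral_swap (f := fun τ x => ⟪h τ x, φ x⟫) hFint
  -- the inner time integral
  have hhi : ∀ x, IntegrableOn (fun τ => h τ x) (Ioc s t) := fun x => by
    have hc : ContinuousOn (fun τ => h τ x) (Icc s t) :=
      (hhc.mono (prod_mono hIJ Subset.rfl)).comp (continuous_id.prodMk continuous_const).continuousOn
        fun τ hτ => ⟨hτ, mem_univ _⟩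
    exact (hc.integrableOn_compact isCompact_Icc).mono_set Ioc_subset_Icc_self
  have hinner : ∀ x, ∫ τ in Ioc s t, ⟪h τ x, φ x⟫ = ⟪∫ τ in s..t, h τ x, φ x⟫ := fun x => by
    rw [intervalIntegral.integral_of_le hst, real_inner_comm, ← integral_inner (𝕜 := ℝ) (hhi x) (φ x)]
    exact integral_congr_ae (Eventually.of_forall fun τ => real_inner_comm _ _)
  -- integrability in `x` of the paired increment and of the paired time integral
  have hP : ∀ x, ‖∫ τ in s..t, h τ x‖ ≤ Ch * |t - s| := fun x =>
    norm_integral_le_of_norm_le_const fun τ hτ => hhb τ (hIJ ⟨(uIoc_of_le hst ▸ hτ).1.le,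
      (uIoc_of_le hst ▸ hτ).2⟩) x
  have hPm : AEStronglyMeasurable (fun x => ∫ τ in s..t, h τ x) volume := by
    have hm : AEStronglyMeasurable (fun p : E × ℝ => h p.2 p.1) ((volume : Measure E).prod μ) := by
      have h' : ContinuousOn (fun p : ℝ × E => h p.1 p.2) (Ioc s t ×ˢ univ) :=
        hhc.mono (prod_mono (Ioc_subset_Icc_self.trans hIJ) Subset.rfl)
      have ha : AEStronglyMeasurable (fun p : ℝ × E => h p.1 p.2) (μ.prod volume) := by
        have := h'.aestronglyMeasurable (μ := (volume : Measure (ℝ × E)))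
          (measurableSet_Ioc.prod MeasurableSet.univ)
        rwa [show (volume : Measure (ℝ × E)).restrict (Ioc s t ×ˢ univ) = μ.prod volume by
          rw [hμ, Measure.volume_eq_prod, ← Measure.prod_restrict, Measure.restrict_univ]] at this
      exact ha.prod_swap
    have := hm.integral_prod_right'
    simp only [intervalIntegral.integral_of_le hst, ← hμ]
    exact this
  have i1 : Integrable fun x => ⟪u t x - u s x, φ x⟫ :=
    integrable_inner_of_hasCompactSupport_right ((hxc t htJ).sub (hxc s hsJ)) hφc hφs
  have i2 : Integrable fun x => ⟪∫ τ in s..t, h τ x, φ x⟫ := by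
    refine (hφint.norm.const_mul (Ch * |t - s|)).mono' (hPm.inner hφc.aestronglyMeasurable)
      (Eventually.of_forall fun x => ?_)
    exact (norm_inner_le_norm _ _).trans (mul_le_mul_of_nonneg_right (hP x) (norm_nonneg _))
  -- assemble
  have hGts : G t - G s = ∫ x, ⟪u t x - u s x, φ x⟫ := by
    have it : Integrable fun x => ⟪u t x, φ x⟫ := integrable_inner_of_hasCompactSupport_right (hxc t htJ) hφc hφs
    have is : Integrable fun x => ⟪u s x, φ x⟫ := integrable_inner_of_hasCompactSupport_right (hxc s hsJ) hφc hφs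
    rw [hG, ← integral_sub it is]
    exact integral_congr_ae (Eventually.of_forall fun x => (inner_sub_left _ _ _).symm)
  have hfin : ∫ x, ⟪u t x - u s x - ∫ τ in s..t, h τ x, φ x⟫ =
      (∫ x, ⟪u t x - u s x, φ x⟫) - ∫ x, ⟪∫ τ in s..t, h τ x, φ x⟫ := by
    rw [← integral_sub i1 i2]
    exact integral_congr_ae (Eventually.of_forall fun x => inner_sub_left _ _ _)
  rw [hh] at hfin
  rw [hfin, ← hh, ← hGts, hFTC, hswap, integral_congr_ae (Eventually.of_forall hinner), sub_self]

end Main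

end Literature.Analysis.FluidPDE

end
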